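import Summits.ResolutionOfSingularities.ResolutionOfSingularities.Theorems.TameTwoStoreyLU3
import Summits.ResolutionOfSingularities.ResolutionOfSingularities.Theorems.TameTwoStoreyLU4
import Summits.ResolutionOfSingularities.ResolutionOfSingularities.Theorems.TameTwoStoreyLU5
import HarnessLib

/-!
# TameTwoStoreyLU6 — steps (5)–(11) of the law from the inertia frame: `relLU_of_twoStoreyFrame` (T-eigenvectors, isotypic stability, ONE model-clause call, STEPS C, D, E, F)

One of the landing files of the g29 node «TameTwoStorey» of the ROOT/RESIDUAL decomposition cell `decomp-res` (lens 1,
window (W-α) WHOLE; files `TameTwoStoreyLU`, `…LU1B`, `…LU2` (landed), `…LU3`–`…LU8`); see the module docstring of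
`Summits.ResolutionOfSingularities.ResolutionOfSingularities.Theorems.TameTwoStoreyLU` for the thesis, the cell
`TameOverInertLUAbove k O` (in `…LU2`), the law `relLU_of_tameOverInertLUAbove : TameOverInertLUAbove k O →
RelLocalUniformization k K O` (in `…LU7`), the paper instances and the sources.  This file: `relLU_of_twoStoreyFrame` only.
Imports: `…TameTwoStoreyLU3`, `…LU4`, `…LU5`.  Problem side, sorry-free, hypothesis-free; every heavy theorem carries
`set_option maxHeartbeats … in` BEFORE its docstring — keep it.
-/

noncomputable section

open IsLocalRing Polynomial IntermediateField Literature.AlgebraicGeometry.Resolution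
open Summit.ResolutionOfSingularities.ResolutionOfSingularities.Theorems.TameQuotientLU
open Summit.ResolutionOfSingularities.ResolutionOfSingularities.Theorems.TameAbelianQuotientLU
open Summit.ResolutionOfSingularities.ResolutionOfSingularities.Theorems.InertiaIsotypicStability
open Summit.ResolutionOfSingularities.ResolutionOfSingularities.Theorems.TameInertialLU
open Summit.ResolutionOfSingularities.ResolutionOfSingularities.Theorems.TameAbelianMonomialChart

namespace Summit.ResolutionOfSingularities.ResolutionOfSingularities.Theorems.TameTwoStoreyLU

universe u

section Law

variable (k : Type) [Field k] {K : Type} [Field K] [Algebra k K]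

variable {k}

set_option maxHeartbeats 2000000 in
/-- **The two-storey law from the inertia frame** (steps (5)–(11) of `relLU_of_tameOverInertLUAbove`): given the
frame facts of a tame-over-inert Galois top — `G`-invariance of `v′`, the enumerated inertia automorphisms `τ`
(exponent `e ∈ O′×`, commuting, residually trivial, fixing `ζ`, normalised by `G`), their fixed field `K_T`
(`G`-stable, containing `ι(K)`), a residual SEPARATOR `x_s ∈ O′ ∩ K_T` of `G/T` with `Stab_G(x_s) ⊆ T`,
residues of `O′` algebraic over `k`, and the `z`-enriched `G`-equivariant model clause for the model `R` — the
conclusion of `RelLocalUniformization` holds for `R`: `T`-EIGENVECTORS `f_c ∈ O′` for the occurring characters and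
ISOTYPIC STABILITY (`InertiaIsotypicStability.isotypic_stability`) make the twisting quotients `g f_c / g′ f_c`
`T`-fixed units; ONE call of the model clause with `z = G · ({ζ, x_s} ∪ {f_c} ∪ {g f_c / g′ f_c})`; then
`exists_semiInvariant_regularParameters` (STEP C), `exists_stable_fixed_chart` (STEP D),
`exists_descended_model_of_inert` (STEP E, in the frame `exists_galFrame`) and `relLU_transport` (STEP F).
[cite: CossartPiltant2008, Lemma 9.4] [cite: CossartPiltant2019, Prop. 4.10] -/
theorem relLU_of_twoStoreyFrame {K' : IntermediateField K (AlgebraicClosure K)} [FiniteDimensional K K']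
    [IsGalois K K'] {O : ValuationSubring K} {O' : ValuationSubring K'}
    (hO'O : O'.comap (algebraMap K K') = O)
    (hGO' : ∀ (g : K' ≃ₐ[K] K') (y : K'), y ∈ O' ↔ g y ∈ O')
    (hgv : ∀ (g : K' ≃ₐ[K] K') (y : K'), O'.valuation (g y) = O'.valuation y)
    {e : ℕ} (he : 0 < e) (hve : O'.valuation (e : K') = 1)
    (hμO : ({w : K' | w ^ e = 1} : Set K') ⊆ O')
    (hμ : ∀ a ∈ ({w : K' | w ^ e = 1} : Set K'), ∀ b ∈ ({w : K' | w ^ e = 1} : Set K'), a ≠ b →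
      O'.valuation (a - b) = 1)
    {ζ : K'} (hζe : ζ ^ e = 1) (hζ0 : ζ ≠ 0) (hζO' : ζ ∈ O')
    (hvη : ∀ j : ℕ, 0 < j → j < e → O'.valuation (ζ ^ j - 1) = 1)
    (T : Subgroup (K' ≃ₐ[K] K')) (τ : ℕ → K' ≃+* K') (r : ℕ)
    (hτapp : ∀ i < r, ∃ g : K' ≃ₐ[K] K', ∀ z, τ i z = g z)
    (hτe : ∀ i < r, τ i ^ e = 1) (hcomm : ∀ i < r, ∀ i' < r, ∀ z : K', τ i (τ i' z) = τ i' (τ i z))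
    (hτres : ∀ i < r, ∀ y ∈ O', O'.valuation (τ i y - y) < 1) (hτζ : ∀ i < r, τ i ζ = ζ)
    (hnormal : ∀ (g : K' ≃ₐ[K] K') (i : ℕ), i < r → ∃ i', i' < r ∧ ∀ y, τ i (g y) = g (τ i' y))
    (KT : Subfield K') (hKT : ∀ z : K', z ∈ KT ↔ ∀ i < r, τ i z = z)
    (hKT' : ∀ z : K', z ∈ KT ↔ ∀ g ∈ T, g z = z)
    (hGKT : ∀ (g : K' ≃ₐ[K] K') (z : K'), z ∈ KT ↔ g z ∈ KT) (hKKT : ∀ x : K, algebraMap K K' x ∈ KT)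
    {xs : K'} (hxsO : xs ∈ O') (hxsKT : xs ∈ KT) (hfixT : ∀ g : K' ≃ₐ[K] K', g xs = xs → g ∈ T)
    (hxsep : ∀ g : K' ≃ₐ[K] K', g ∉ T → O'.valuation (xs - g xs) = 1)
    (halgO : ∀ y ∈ O', ∃ f : Polynomial k, f ≠ 0 ∧ Polynomial.aeval y f ∈ O'.nonunits)
    {R : Subalgebra k K} (hRfg : R.FG) (hRfrac : IsFractionRing R K)
    (hLU : ∀ z : Finset K', (↑z : Set K') ⊆ O' → (∀ g : K' ≃ₐ[K] K', ∀ y ∈ z, g y ∈ z) →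
      ∃ t₀ : Finset K', (↑z : Set K') ⊆ modelAbove k R K' t₀ ∧ modelAbove k R K' t₀ ≤ O'.toSubring ∧
        (∀ g : K' ≃ₐ[K] K', ∀ y ∈ modelAbove k R K' t₀, g y ∈ modelAbove k R K' t₀) ∧
        IsRegularLocalRing (locAtCentre (modelAbove k R K' t₀) O')) :
    ∃ (A : Subalgebra k K) (h : A.toSubring ≤ O.toSubring), R ≤ A ∧ A.FG ∧
      IsRegularLocalRing (Localization.AtPrime
        (Ideal.comap (Subring.inclusion h) (IsLocalRing.maximalIdeal O))) := by
  classical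
  have he0 : e ≠ 0 := he.ne'
  have hmemO : ∀ x : K, x ∈ O ↔ algebraMap K K' x ∈ O' := fun x => by
    rw [← hO'O]
    rfl
  have hgf : ∀ (g : K' ≃ₐ[K] K') (x : K), g (algebraMap K K' x) = algebraMap K K' x :=
    fun g x => g.commutes x
  have hfk : ∀ c : k, algebraMap K K' (algebraMap k K c) = algebraMap k K' c := fun c =>
    (IsScalarTower.algebraMap_apply k K K' c).symm
  -- (5) `T`-eigenvectors `f_c ∈ O′` for the characters `c : Fin r → Fin e` that occur, and their twists
  let P : (Fin r → Fin e) → Prop := fun c =>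
    ∃ f : K', f ≠ 0 ∧ f ∈ O' ∧ ∀ i (hi : i < r), τ i f = ζ ^ ((c ⟨i, hi⟩ : Fin e) : ℕ) * f
  let fc : (Fin r → Fin e) → K' := fun c => if hc : P c then hc.choose else 1
  have hfcP : ∀ c, P c → fc c ≠ 0 ∧ fc c ∈ O' ∧
      ∀ i (hi : i < r), τ i (fc c) = ζ ^ ((c ⟨i, hi⟩ : Fin e) : ℕ) * fc c := by
    intro c hc
    have h1 : fc c = hc.choose := dif_pos hc
    rw [h1]
    exact hc.choose_spec
  have hfc1 : ∀ c, ¬ P c → fc c = 1 := fun c hc => dif_neg hc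
  have hfc0 : ∀ c, fc c ≠ 0 := by
    intro c
    by_cases hc : P c
    · exact (hfcP c hc).1
    · rw [hfc1 c hc]; exact one_ne_zero
  have hfcO : ∀ c, fc c ∈ O' := by
    intro c
    by_cases hc : P c
    · exact (hfcP c hc).2.1
    · rw [hfc1 c hc]; exact one_mem O'
  -- ISOTYPIC STABILITY: `g f_c` is again a `T`-eigenvector with the SAME character
  have hgeig : ∀ c, P c → ∀ (g : K' ≃ₐ[K] K') (i : ℕ) (hi : i < r),
      τ i (g (fc c)) = ζ ^ ((c ⟨i, hi⟩ : Fin e) : ℕ) * g (fc c) := by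
    intro c hc g i hi
    obtain ⟨i', hi', hc'⟩ := hnormal g i hi
    have h := isotypic_stability O' (g := (g : K' ≃+* K')) (t := τ i) (t' := τ i') (hgv g)
      (hτres i hi) (fun y => hc' y) hμO hμ (f := fc c) (c := ζ ^ ((c ⟨i, hi⟩ : Fin e) : ℕ))
      (c' := ζ ^ ((c ⟨i', hi'⟩ : Fin e) : ℕ)) (hfc0 c)
      (by rw [Set.mem_setOf_eq, ← pow_mul, mul_comm, pow_mul, hζe, one_pow])
      (by
        show (g (ζ ^ ((c ⟨i', hi'⟩ : Fin e) : ℕ))) ^ e = 1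
        rw [← map_pow, ← pow_mul, mul_comm, pow_mul, hζe, one_pow, map_one])
      (pow_ne_zero _ hζ0) ((hfcP c hc).2.2 i hi) ((hfcP c hc).2.2 i' hi')
    exact h.2
  -- the twisting quotients `g f_c / g' f_c` are `T`-fixed units of `O′`
  have hquotT : ∀ (c) (g g' : K' ≃ₐ[K] K'), g (fc c) / g' (fc c) ∈ KT := by
    intro c g g'
    rw [hKT]
    intro i hi
    by_cases hc : P c
    · rw [map_div₀, hgeig c hc g i hi, hgeig c hc g' i hi,
        mul_div_mul_left _ _ (pow_ne_zero _ hζ0)]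
    · rw [hfc1 c hc, map_one, map_one, div_one, map_one]
  have hquotv : ∀ (c) (g g' : K' ≃ₐ[K] K'), O'.valuation (g (fc c) / g' (fc c)) = 1 := by
    intro c g g'
    rw [map_div₀, hgv, hgv, div_self]
    exact (Valuation.ne_zero_iff _).mpr (hfc0 c)
  have hquotO : ∀ (c) (g g' : K' ≃ₐ[K] K'), g (fc c) / g' (fc c) ∈ O' := fun c g g' =>
    (O'.valuation_le_one_iff _).mp (hquotv c g g').le
  -- (6) the finite `G`-stable set `z ⊆ O′` and ONE application of the model clause
  let z₀ : Finset K' := insert ζ (insert xs (Finset.univ.image fc ∪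
    (Finset.univ.image fun p : (K' ≃ₐ[K] K') × (K' ≃ₐ[K] K') × (Fin r → Fin e) =>
      p.1 (fc p.2.2) / p.2.1 (fc p.2.2))))
  have hz₀O : ∀ w ∈ z₀, w ∈ O' := by
    intro w hw
    rcases Finset.mem_insert.mp hw with rfl | hw
    · exact hζO'
    rcases Finset.mem_insert.mp hw with rfl | hw
    · exact hxsO
    rcases Finset.mem_union.mp hw with hw | hw
    · obtain ⟨c, -, rfl⟩ := Finset.mem_image.mp hw
      exact hfcO c
    · obtain ⟨p, -, rfl⟩ := Finset.mem_image.mp hw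
      exact hquotO _ _ _
  have hζz₀ : ζ ∈ z₀ := Finset.mem_insert_self _ _
  have hxz₀ : xs ∈ z₀ := Finset.mem_insert_of_mem (Finset.mem_insert_self _ _)
  have hfz₀ : ∀ c, fc c ∈ z₀ := fun c => Finset.mem_insert_of_mem (Finset.mem_insert_of_mem
    (Finset.mem_union_left _ (Finset.mem_image.mpr ⟨c, Finset.mem_univ _, rfl⟩)))
  have hqz₀ : ∀ (c) (g g' : K' ≃ₐ[K] K'), g (fc c) / g' (fc c) ∈ z₀ := fun c g g' =>
    Finset.mem_insert_of_mem (Finset.mem_insert_of_mem (Finset.mem_union_right _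
      (Finset.mem_image.mpr ⟨(g, g', c), Finset.mem_univ _, rfl⟩)))
  let z : Finset K' := (Finset.univ ×ˢ z₀).image fun p : (K' ≃ₐ[K] K') × K' => p.1 p.2
  have hz₀z : ∀ w ∈ z₀, w ∈ z := fun w hw =>
    Finset.mem_image.mpr ⟨(1, w), Finset.mem_product.mpr ⟨Finset.mem_univ _, hw⟩, rfl⟩
  have hzO : (↑z : Set K') ⊆ O' := by
    intro w hw
    obtain ⟨p, hp, rfl⟩ := Finset.mem_image.mp (Finset.mem_coe.mp hw)
    exact (hGO' p.1 p.2).mp (hz₀O p.2 (Finset.mem_product.mp hp).2)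
  have hzG : ∀ g : K' ≃ₐ[K] K', ∀ y ∈ z, g y ∈ z := by
    intro g y hy
    obtain ⟨p, hp, rfl⟩ := Finset.mem_image.mp hy
    exact Finset.mem_image.mpr ⟨(g * p.1, p.2),
      Finset.mem_product.mpr ⟨Finset.mem_univ _, (Finset.mem_product.mp hp).2⟩, rfl⟩
  obtain ⟨t₀, hzM, hMO, hGM, hreg⟩ := hLU z hzO hzG
  set S' : Subring K' := R.toSubring.map (algebraMap K K' : K →+* K') with hS'def
  set M : Subring K' := modelAbove k R K' t₀ with hMdef
  have hMcl : M = Subring.closure ((S' : Set K') ∪ (t₀ : Set K')) := rfl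
  have hzM' : ∀ w ∈ z₀, w ∈ M := fun w hw => hzM (Finset.mem_coe.mpr (hz₀z w hw))
  have hBdim : ringKrullDim (locAtCentre M O') = ((maximalIdeal (locAtCentre M O')).spanFinrank : ℕ) :=
    (IsRegularLocalRing.spanFinrank_maximalIdeal (R := locAtCentre M O')).symm
  -- the base `S' = ι(R)` is fixed by `G`, universally catenary, contains `k`; residues are algebraic over it
  have hRS : ∀ x ∈ R, algebraMap K K' x ∈ S' := fun x hx => Subring.mem_map.mpr ⟨x, hx, rfl⟩
  have hGS' : ∀ (g : K' ≃ₐ[K] K'), ∀ s ∈ S', g s = s := by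
    intro g s hs
    obtain ⟨x, -, rfl⟩ := Subring.mem_map.mp hs
    exact hgf g x
  haveI : Algebra.FiniteType k R := (Subalgebra.fg_iff_finiteType R).mp hRfg
  have hSuc : IsUniversallyCatenaryRing S' :=
    (isUniversallyCatenaryRing_of_finiteType_field k R).of_surjective
      ((algebraMap K K' : K →+* K').restrict R S' hRS) (by
        rintro ⟨y, hy⟩
        obtain ⟨x, hx, rfl⟩ := Subring.mem_map.mp hy
        exact ⟨⟨x, hx⟩, rfl⟩)
  have hkS : ∀ c : k, algebraMap k K' c ∈ S' := fun c => by
    rw [← hfk]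
    exact hRS _ (R.algebraMap_mem c)
  let ψ : k →+* S' := (algebraMap k K').codRestrict _ hkS
  have hS'KT : S' ≤ KT.toSubring := fun s hs => by
    obtain ⟨x, -, rfl⟩ := Subring.mem_map.mp hs
    exact hKKT x
  have hcompψ : (algebraMap S' K').comp ψ = algebraMap k K' := RingHom.ext fun _ => rfl
  have halg : ∀ w : O', ∃ q : Polynomial S', (∃ i, IsUnit (q.coeff i)) ∧
      O'.valuation (Polynomial.aeval (w : K') q) < 1 := by
    intro w
    obtain ⟨f₁, hf₁0, hf₁w⟩ := halgO w w.2
    refine ⟨f₁.map ψ, ⟨f₁.natDegree, ?_⟩, ?_⟩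
    · rw [coeff_map]
      exact (IsUnit.mk0 _ (leadingCoeff_ne_zero.mpr hf₁0)).map ψ
    · have hq : Polynomial.aeval (w : K') (f₁.map ψ) = Polynomial.aeval (w : K') f₁ := by
        rw [aeval_def, eval₂_map, hcompψ, ← aeval_def]
      rw [hq]
      exact (O'.mem_nonunits_iff).mp hf₁w
  have hS'frac : ∀ x : K, ∃ a ∈ S', ∃ b ∈ S', algebraMap K K' x = a / b := by
    intro x
    haveI := hRfrac
    obtain ⟨a, b, -, hab⟩ := IsFractionRing.div_surjective (A := R) x
    refine ⟨algebraMap K K' (a : K), hRS _ a.2, algebraMap K K' (b : K), hRS _ b.2, ?_⟩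
    rw [← hab, map_div₀]
    rfl
  -- the `K_T`-frame `H′ = G|_{K_T}`, `K₀`, and the separator read in it
  obtain ⟨H', K₀, h1H, hmulH, hK, hK₀, hH'G, -, hHO⟩ := exists_galFrame KT hGKT O' hGO'
  have hsepE : ∀ h ∈ H', h ≠ 1 →
      (O'.comap KT.subtype).valuation ((⟨xs, hxsKT⟩ : KT) - h ⟨xs, hxsKT⟩) = 1 := by
    intro h hh hne
    obtain ⟨g, hg⟩ := hH'G h hh
    have hgT : g ∉ T := fun hgT => hne (RingEquiv.ext fun w =>
      Subtype.ext ((hg w).trans ((hKT' (w : K')).mp w.2 g hgT)))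
    rw [StableRestrict.valuation_comap_eq_one_iff]
    have h1 := hxsep g hgT
    simpa [hg] using h1
  -- (7)–(8) STEP C; (9) STEP D; (10) STEP E; (11) STEP F
  obtain ⟨u, s', ε, huspan, hu0, hτu, hgu, hεM, hεKT'⟩ :=
    exists_semiInvariant_regularParameters hgv he hve τ r hτapp hτe hcomm hζe hζ0 hτζ hvη KT
      hKT hMO hGM (hzM' ζ hζz₀) hxsKT (hzM' xs hxz₀) hreg hBdim fc hfc0 (fun c => hzM' _ (hfz₀ c))
      (fun c hc => (hfcP c hc).2.2) hgeig (fun c g g' => hzM' _ (hqz₀ c g g')) hquotT H' K₀ h1H hmulH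
      hK hK₀ hHO hH'G hsepE
  obtain ⟨tt, hT₁O, hT₁KT, hxT₁, hGT₁, hT₁reg⟩ :=
    exists_stable_fixed_chart hGO' hgv he hve τ r hτapp hτe hcomm hτres hnormal hζe hτζ hvη KT hKT S'
      hSuc hGS' halg t₀ hMcl hMO hGM (hzM' ζ hζz₀) hxsKT (hzM' xs hxz₀) hreg hBdim u huspan hu0 s' hτu ε
      hgu hεM hεKT'
  obtain ⟨tK, htKsub, hT₂O, hT₂reg⟩ :=
    exists_descended_model_of_inert T KT hKT' hKKT hxsKT hfixT H' K₀ h1H hmulH hK hK₀ hH'G hsepE S'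
      hSuc.1 hS'KT hGS' hS'frac tt hT₁O hT₁KT hxT₁ hGT₁ hT₁reg
  exact relLU_transport hO'O hRfg tK htKsub hT₂O hT₂reg

end Law

end Summit.ResolutionOfSingularities.ResolutionOfSingularities.Theorems.TameTwoStoreyLU

end
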